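/-
Copyright (c) 2026 the pub-hodgecm-mathlib formalisation cell (harness21).  Prover seat hodgecm-mathlib-K2E3-p34 (g2), Track B «K2-LIT» ∕ h413 = `stmt-HodgeConjecture-24833`,
line `K2_E3_EllipticInputs`, unit U4 «Keys», socket :182 `sig_K2E3KeysThmTwoContractingRamifiedCharOnePosDepth`, programme A_pos^{<}: brick (v)-θ^{<} «THE CHARACTER
`j ↦ χ₁(j₀₀)` OF A TWO-DEPTH LEVEL GROUP OF `U(σ, Φ₃)(K)`» — the two-depth twin of ★ `K2E3LevelNIwahoriCharacter` (K2E3-p37 (g0)); default offer (β) 2026-09-04T22:07:48Z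
under L4 LINE-LEAD K2E3-plan (g5) ROUND 3; statement letters of K2E3-p14 (g9)'s D174 `K2E3IwahoriTwoDepthFactorisation` (`e`, `Jg`, `hJg`).  REPORT-FIRST 2026-09-04.
-/
import Summits.HodgeConjecture.HodgeConjecture.Theorems.K2E3IwahoriTwoDepthFactorisation   -- ★ D174 (K2E3-p14 g9): the letters `e`, `Jg`, `hJg`, `le_glInt_subgroupOf`, the pivot `v_apply_zero_zero_eq_one_of_mem`; brings the `U(σ,Φ₃)` entry API
import HarnessLib

/-!
# K2 ∕ E3 «EllipticInputs», unit U4 «Keys» — (U4f-χ₁-ram-one-pos), programme A_pos^{<} brick (v)-θ^{<}: THE CHARACTER `j ↦ χ₁(j₀₀)` OF A TWO-DEPTH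
# (CONCAVE-EXPONENT) LEVEL GROUP OF `U(σ, Φ₃)(K)` — «`θ(jj′) = θ(j)θ(j′)` once the SHORT-root depths add up to cond_E `χ₁` and the LONG-root depths add up to
# cond_F `χ₁` (the conductor on the `σ`-fixed units)»   [Roche1998 §3; MoyPrasad1996 §3; BruhatTits1972 (4.4.4), (6.4.9); Casselman1995 §1.4; Rogawski1990 §1.9–§1.10]

Cell hodgecm-mathlib, Track B «K2-LIT», crux item H413 = stmt-HodgeConjecture-24833 (route `HCCMUnconditional`, no route verbs); target BY NAME the OPEN tier-0 leaf
`…K2E3EllipticInputs.U4Keys.sig_K2E3KeysThmTwoContractingRamifiedCharOnePosDepth` (U4Keys :182), regime A_pos^{<} (p37 (g0) memo `K2/K2E3-p37/g0/CENSUS-U4f-PosDepth…md`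
§9: «with the UNIFORM `J_n` some intermediate cells ARE θ-relevant when `c_F := cond(χ₁|_{F×}) < n`; bricks (i), (v)-θ, (v)-CM need TWO-DEPTH twins»).  Author K2E3-p34 (g2).
`--supports stmt-HodgeConjecture-24833 --as helper`; THEOREMS ONLY (no `def` ∕ `instance` ∕ `notation` ∕ named fact ∕ `sorry`); MODEL level (`U(σ, Φ₃)(K)`, `Valued K ℤᵐ⁰`,
an isometric involution `σ`, a uniformiser `ϖ`).  NOT THE PAYER of :182.  Brick (i)^{<} (the group, its factorisation) is K2E3-p14 (g9)'s D174 `K2E3IwahoriTwoDepthFactorisation`;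
this file needs NO factorisation — it is hypothesis-first over D174's membership letter `hJg : ∀ k, k ∈ Jg ↔ ∀ i j, |k i j| ≤ |ϖ| ^ e i j` (§3) and, underneath, over bare
ENTRY bounds (§2) and pure field algebra (§1).

THE POINT.  Design D-I's type vector (★ V2b `K2E3TypeVectorOfSubrepFactored`) needs `θ : G → ℂ` MULTIPLICATIVE on the type group; the recipe `θ(j) := χ₁(j₀₀)` works on the
uniform `J_n` for cond `χ₁ ≤ n` (★ `K2E3LevelNIwahoriCharacter`: `(jj′)₀₀ − j₀₀j′₀₀ = j₀₁j′₁₀ + j₀₂j′₂₀ ∈ 𝔭ⁿ`).  On a two-depth group (N-side `j₀₁ ∈ 𝔭^r`, `j₀₂ ∈ 𝔭^s`;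
N̄-side `j′₁₀ ∈ 𝔭^{r′}`, `j′₂₀ ∈ 𝔭^{s′}`) that crude bound needs cond `χ₁ ≤ min(r + r′, s + s′)` — useless in Roche's regime `s + s′ = c_F < n`.  The refinement is the
`U(2,1)` structure of the long-root term: `(jj′)₀₀ = j₀₀·j′₀₀·(1 + ỹx̃ + b̃z̃)` (entries normalised by the unit pivots) with the ISOTROPY relations `b̃ + σb̃ + ỹσỹ = 0`
(row `0` of `j`), `z̃ + σz̃ + x̃σx̃ = 0` (column `0` of `j′`); with a TRACE-ONE `t` (`t + σt = 1`, `|t| ≤ 1`; K2E3-p37 (g2)'s letter of ★ `K2E3LevelNDepthWitnessTraceOne`)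
and `β := b̃ + t·ỹσỹ`, `ζ := z̃ + t·x̃σx̃` one has `σβ = −β`, `σζ = −ζ` and
  `1 + ỹx̃ + b̃z̃ = (1 + βζ) + (ỹx̃ − tβ·x̃σx̃ − tζ·ỹσỹ + t²·ỹσỹ·x̃σx̃)`,
`βζ` `σ`-FIXED with `|βζ| ≤ |ϖ|^c` and the bracket in `𝔭ⁿ` as soon as `n ≤ r + r′`, `n ≤ 2r + s′`, `n ≤ s + 2r′`, `c ≤ s + s′` (`1 ≤ c ≤ n`) — the Bruhat–Tits ∕ Roche
CONCAVITY inequalities.  Hence `χ₁((jj′)₀₀) = χ₁(j₀₀)χ₁(j′₀₀)` for `χ₁` trivial on `{u : |u − 1| ≤ |ϖ|ⁿ}` AND on the `σ`-fixed `{u : σu = u, |u − 1| ≤ |ϖ|^c}`.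
§1 is the field-level identity `χ₁(1 + ỹx̃ + b̃z̃) = 1` (`chi_mk0_one_add_eq_one_of_traceOne`; crude twin `chi_mk0_one_add_eq_one` for `n ≤ r + r′`, `n ≤ s + s′`, no `t`);
§2 the ENTRY-BOUND statements on `U(σ, Φ₃)` (`chi_mul_apply_zero_zero_of_traceOne` ∕ `_of_le_add`, via `(jj′)₀₀ = j₀₀j′₀₀(1 + ỹx̃ + b̃z̃)` and the isotropy relations ★
`sum_rel_of_mem` ∕ ★ `col_zero_isotropic`); §3 the same over ★ D174's letters `(e) (Jg) (hJg)` and its pivot ★ `v_apply_zero_zero_eq_one_of_mem` (`chi_apply_zero_zero_mul_of_concave` = the (v)-θ^{<}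
letter `hθmul`; `chi_apply_zero_zero_mul_of_le_add`, whose instance `e = ![![0,0,0],![n,0,0],![n,n,0]]` is ★ `chi_apply_zero_zero_mul_pow`).
HONEST LABEL: HC_CM is proved only modulo the 7 printed citations (2 remaining named inputs: hLiu418 = stmt-HodgeConjecture-24832, h413 = stmt-HodgeConjecture-24833)
until rung 0 closes; count-neutral — this file pays no socket and closes nothing; no printed citation is discharged.

## References
* [Roche1998] A. Roche, *Types and Hecke algebras for principal series representations of split reductive p-adic groups*, Ann. Sci. ÉNS (4) 31 (1998), §2–§3.
* [MoyPrasad1996] A. Moy, G. Prasad, *Jacquet functors and unrefined minimal K-types*, Comment. Math. Helv. 71 (1996), §3.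
* [BruhatTits1972] F. Bruhat, J. Tits, *Groupes réductifs sur un corps local I*, Publ. Math. IHÉS 41 (1972), (4.4.4), (6.4.9) (concave functions, the groups `P_f`).
* [Casselman1995] W. Casselman, *Introduction to the theory of admissible representations of `p`-adic reductive groups* (1995), §1.4.
* [Rogawski1990] J. D. Rogawski, *Automorphic Representations of Unitary Groups in Three Variables* (1990), §1.9–§1.10 pp. 8–9 (`U(Φ₃)`, `B = TN`, `w`).
-/

set_option autoImplicit false
-- the mandated namespace repeats the single-problem summit's segment (`HodgeConjecture.HodgeConjecture`)
set_option linter.dupNamespace false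

noncomputable section

open Matrix Literature.NumberTheory.Automorphic Literature.NumberTheory.Automorphic.UnitaryGroup
open scoped Matrix MatrixGroups WithZero

namespace Summit.HodgeConjecture.HodgeConjecture.Cruxes.H413.K2E3ConcaveLevelIwahoriCharacter

open Summit.HodgeConjecture.HodgeConjecture.Cruxes.H413

/-! ## §1 Field level: `χ₁(1 + ỹx̃ + b̃z̃) = 1` from the isotropy relations and a trace-one element -/

section FieldLevel

variable {K : Type*} [Field K] [Valued K ℤᵐ⁰] (σ : K →+* K) {ϖ : K}
  (hσ : ∀ a, σ (σ a) = a) (hvσ : ∀ a, Valued.v (σ a) = Valued.v a) (hvϖ : Valued.v ϖ = WithZero.exp (-1 : ℤ))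

omit [Valued K ℤᵐ⁰] in
include hσ in
/-- **`σβ = −β` for `β := b + t·yσy`** when `b + σb + yσy = 0` and `t + σt = 1`: the trace-one element splits off the `σ`-ANTI-invariant part of the long-root coordinate
(`t = ½`: `β = b + ½yσy` is the «imaginary part» of `b`). [cite: Rogawski1990, §1.10 p. 9] [cite: Roche1998, §3] -/
theorem sigma_add_mul_eq_neg {t y b : K} (ht : t + σ t = 1) (hb : b + σ b + y * σ y = 0) :
    σ (b + t * (y * σ y)) = -(b + t * (y * σ y)) := by
  rw [map_add, map_mul, map_mul, hσ]
  linear_combination hb + (y * σ y) * ht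

omit [Valued K ℤᵐ⁰] in
/-- **The trace-one decomposition of `1 + yx + bz`**: with `β := b + t·yσy`, `ζ := z + t·xσx`,
`1 + yx + bz = (1 + βζ) + (yx − tβ·xσx − tζ·yσy + t²·yσy·xσx)` (a ring identity: `b = β − t·yσy`, `z = ζ − t·xσx`). [cite: Roche1998, §3] [cite: BruhatTits1972, (6.4.9)] -/
theorem one_add_mul_add_mul_eq (t y b x z : K) :
    1 + y * x + b * z =
      (1 + (b + t * (y * σ y)) * (z + t * (x * σ x))) +
        (y * x - t * (b + t * (y * σ y)) * (x * σ x) - t * (z + t * (x * σ x)) * (y * σ y) + t * t * (y * σ y) * (x * σ x)) := by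
  ring

include hvϖ in
/-- `|ϖ|^m ≤ |ϖ|^k` for `k ≤ m` (`|ϖ| ≤ 1`). [cite: BruhatTits1972, (6.4.9)] -/
theorem v_pow_le_pow_of_le {k m : ℕ} (hkm : k ≤ m) : Valued.v ϖ ^ m ≤ Valued.v ϖ ^ k := by
  have hvϖ1 : Valued.v ϖ ≤ 1 := by rw [hvϖ, ← WithZero.exp_zero, WithZero.exp_le_exp]; norm_num
  exact pow_le_pow_right_of_le_one' hvϖ1 hkm

/-- `|p| ≤ |ϖ|^i`, `|q| ≤ |ϖ|^j` ⟹ `|pq| ≤ |ϖ|^{i+j}`. [cite: BruhatTits1972, (6.4.9)] -/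
theorem v_mul_le_pow_add {p q : K} {i j : ℕ} (hp : Valued.v p ≤ Valued.v ϖ ^ i) (hq : Valued.v q ≤ Valued.v ϖ ^ j) :
    Valued.v (p * q) ≤ Valued.v ϖ ^ (i + j) := by
  rw [map_mul, pow_add]; exact mul_le_mul' hp hq

include hvσ hvϖ in
/-- **`|β| ≤ |ϖ|^{min(s, 2r)}`** for `β = b + t·yσy`, `|t| ≤ 1`, `|b| ≤ |ϖ|^s`, `|y| ≤ |ϖ|^r` (`|σy| = |y|`). [cite: BruhatTits1972, (6.4.9)] -/
theorem v_add_mul_le {t y b : K} (hvt : Valued.v t ≤ 1) {r s : ℕ} (hy : Valued.v y ≤ Valued.v ϖ ^ r) (hvb : Valued.v b ≤ Valued.v ϖ ^ s) :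
    Valued.v (b + t * (y * σ y)) ≤ Valued.v ϖ ^ min s (2 * r) :=
  Valued.v.map_add_le (hvb.trans (v_pow_le_pow_of_le hvϖ (min_le_left _ _))) <| by
    rw [map_mul, two_mul]
    exact ((mul_le_mul' hvt (v_mul_le_pow_add hy (by rwa [hvσ]))).trans_eq (one_mul _)).trans (v_pow_le_pow_of_le hvϖ (min_le_right _ _))

include hvσ hvϖ in
/-- **The long-root term `βζ` has valuation `≤ |ϖ|^c`** under the concavity inequalities `c ≤ s + s′`, `c ≤ n ≤ 2r + s′`, `n ≤ s + 2r′`, `n ≤ r + r′`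
(`|β| ≤ |ϖ|^{min(s,2r)}`, `|ζ| ≤ |ϖ|^{min(s′,2r′)}`). [cite: BruhatTits1972, (6.4.9)] [cite: Roche1998, §3] -/
theorem v_beta_mul_zeta_le {t y b x z : K} (hvt : Valued.v t ≤ 1) {n c r s r' s' : ℕ}
    (hy : Valued.v y ≤ Valued.v ϖ ^ r) (hvb : Valued.v b ≤ Valued.v ϖ ^ s) (hx : Valued.v x ≤ Valued.v ϖ ^ r') (hvz : Valued.v z ≤ Valued.v ϖ ^ s')
    (hcn : c ≤ n) (h1 : n ≤ r + r') (h2 : n ≤ 2 * r + s') (h3 : n ≤ s + 2 * r') (h4 : c ≤ s + s') :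
    Valued.v ((b + t * (y * σ y)) * (z + t * (x * σ x))) ≤ Valued.v ϖ ^ c :=
  (v_mul_le_pow_add (v_add_mul_le σ hvσ hvϖ hvt hy hvb) (v_add_mul_le σ hvσ hvϖ hvt hx hvz)).trans (v_pow_le_pow_of_le hvϖ (by omega))

include hvσ hvϖ in
/-- **The correction term lies in `𝔭ⁿ`**: `|yx − tβ·xσx − tζ·yσy + t²·yσy·xσx| ≤ |ϖ|ⁿ` under `n ≤ r + r′`, `n ≤ 2r + s′`, `n ≤ s + 2r′` (each of the four terms is bounded by a product of
the entry bounds; `|t| ≤ 1`, `|σa| = |a|`). [cite: BruhatTits1972, (6.4.9)] [cite: Roche1998, §3] -/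
theorem v_traceOne_correction_le {t y b x z : K} (hvt : Valued.v t ≤ 1) {n r s r' s' : ℕ}
    (hy : Valued.v y ≤ Valued.v ϖ ^ r) (hvb : Valued.v b ≤ Valued.v ϖ ^ s) (hx : Valued.v x ≤ Valued.v ϖ ^ r') (hvz : Valued.v z ≤ Valued.v ϖ ^ s')
    (h1 : n ≤ r + r') (h2 : n ≤ 2 * r + s') (h3 : n ≤ s + 2 * r') :
    Valued.v (y * x - t * (b + t * (y * σ y)) * (x * σ x) - t * (z + t * (x * σ x)) * (y * σ y) + t * t * (y * σ y) * (x * σ x)) ≤ Valued.v ϖ ^ n := by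
  have hβ := v_add_mul_le σ hvσ hvϖ hvt hy hvb
  have hζ := v_add_mul_le σ hvσ hvϖ hvt hx hvz
  have hxx : Valued.v (x * σ x) ≤ Valued.v ϖ ^ (2 * r') := by rw [two_mul]; exact v_mul_le_pow_add hx (by rwa [hvσ])
  have hyy : Valued.v (y * σ y) ≤ Valued.v ϖ ^ (2 * r) := by rw [two_mul]; exact v_mul_le_pow_add hy (by rwa [hvσ])
  have htt : Valued.v (t * t) ≤ 1 := by rw [map_mul]; exact mul_le_one' hvt hvt
  -- `|a| ≤ 1`, `|p| ≤ g` ⟹ `|ap| ≤ g` (as ★ `UnitaryGroup.v_mul_le_of_le_one_of_le`)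
  have hmul1 : ∀ {a p : K} {g : ℤᵐ⁰}, Valued.v a ≤ 1 → Valued.v p ≤ g → Valued.v (a * p) ≤ g := fun ha hp => by
    rw [map_mul]; exact (mul_le_mul' ha hp).trans_eq (one_mul _)
  refine Valued.v.map_add_le (Valued.v.map_sub_le (Valued.v.map_sub_le ?_ ?_) ?_) ?_
  · exact (v_mul_le_pow_add hy hx).trans (v_pow_le_pow_of_le hvϖ h1)
  · exact (v_mul_le_pow_add (hmul1 hvt hβ) hxx).trans (v_pow_le_pow_of_le hvϖ (by omega))
  · exact (v_mul_le_pow_add (hmul1 hvt hζ) hyy).trans (v_pow_le_pow_of_le hvϖ (by omega))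
  · exact (v_mul_le_pow_add (hmul1 htt hyy) hxx).trans (v_pow_le_pow_of_le hvϖ (by omega))

include hσ hvσ hvϖ in
/-- **`χ₁(1 + ỹx̃ + b̃z̃) = 1` — THE TWO-DEPTH CHARACTER IDENTITY, field level.**  Let `χ₁ : Kˣ → ℂˣ` be trivial on `{u : |u − 1| ≤ |ϖ|ⁿ}` («cond_E ≤ n») and on the `σ`-FIXED
`{u : σu = u, |u − 1| ≤ |ϖ|^c}` («cond_F ≤ c», `1 ≤ c ≤ n`); let `t + σt = 1`, `|t| ≤ 1`; let `b + σb + yσy = 0`, `z + σz + xσx = 0` (the row∕column isotropy relations of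
`U(σ, Φ₃)`), with `|y| ≤ |ϖ|^r`, `|b| ≤ |ϖ|^s`, `|x| ≤ |ϖ|^{r′}`, `|z| ≤ |ϖ|^{s′}` and the CONCAVITY inequalities `n ≤ r + r′`, `n ≤ 2r + s′`, `n ≤ s + 2r′`, `c ≤ s + s′`.  Then
`χ₁(1 + yx + bz) = 1`: `1 + yx + bz = (1 + βζ)·u` with `σ(1 + βζ) = 1 + βζ`, `|βζ| ≤ |ϖ|^c` and `|u − 1| ≤ |ϖ|ⁿ` (§1). [cite: Roche1998, §3] [cite: MoyPrasad1996, §3]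
[cite: BruhatTits1972, (6.4.9)] -/
theorem chi_mk0_one_add_eq_one_of_traceOne (χ₁ : Kˣ →* ℂˣ) {n c : ℕ} (hc1 : 1 ≤ c) (hcn : c ≤ n)
    (hcond : ∀ u : Kˣ, Valued.v ((u : K) - 1) ≤ Valued.v ϖ ^ n → χ₁ u = 1)
    (hcondF : ∀ u : Kˣ, σ (u : K) = u → Valued.v ((u : K) - 1) ≤ Valued.v ϖ ^ c → χ₁ u = 1)
    {t : K} (ht : t + σ t = 1) (hvt : Valued.v t ≤ 1)
    {y b x z : K} (hb : b + σ b + y * σ y = 0) (hz : z + σ z + x * σ x = 0)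
    {r s r' s' : ℕ} (hy : Valued.v y ≤ Valued.v ϖ ^ r) (hvb : Valued.v b ≤ Valued.v ϖ ^ s)
    (hx : Valued.v x ≤ Valued.v ϖ ^ r') (hvz : Valued.v z ≤ Valued.v ϖ ^ s')
    (h1 : n ≤ r + r') (h2 : n ≤ 2 * r + s') (h3 : n ≤ s + 2 * r') (h4 : c ≤ s + s')
    (h0 : 1 + y * x + b * z ≠ 0) :
    χ₁ (Units.mk0 (1 + y * x + b * z) h0) = 1 := by
  have hvϖ1 : Valued.v ϖ < 1 := by rw [hvϖ, ← WithZero.exp_zero, WithZero.exp_lt_exp]; norm_num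
  have hvϖc : Valued.v ϖ ^ c < 1 := pow_lt_one' hvϖ1 (Nat.one_le_iff_ne_zero.1 hc1)
  -- the `σ`-fixed factor `1 + βζ`
  set β : K := b + t * (y * σ y) with hβdef
  set ζ : K := z + t * (x * σ x) with hζdef
  have hσβ : σ β = -β := sigma_add_mul_eq_neg σ hσ ht hb
  have hσζ : σ ζ = -ζ := sigma_add_mul_eq_neg σ hσ ht hz
  have hvβζ : Valued.v (β * ζ) ≤ Valued.v ϖ ^ c := v_beta_mul_zeta_le σ hvσ hvϖ hvt hy hvb hx hvz hcn h1 h2 h3 h4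
  have hvF : Valued.v (1 + β * ζ) = 1 := Valued.v.map_one_add_of_lt (hvβζ.trans_lt hvϖc)
  have hF0 : 1 + β * ζ ≠ 0 := fun h => by rw [h, map_zero] at hvF; exact zero_ne_one hvF
  have hχF : χ₁ (Units.mk0 (1 + β * ζ) hF0) = 1 := by
    refine hcondF _ ?_ ?_
    · rw [Units.val_mk0, map_add, map_one, map_mul, hσβ, hσζ, neg_mul_neg]
    · rw [Units.val_mk0, add_sub_cancel_left]; exact hvβζ
  -- the correction `u = (1 + yx + bz) ∕ (1 + βζ)` is `≡ 1 (mod 𝔭ⁿ)`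
  have hE := v_traceOne_correction_le σ hvσ hvϖ hvt (b := b) (z := z) hy hvb hx hvz h1 h2 h3
  have hdecomp := one_add_mul_add_mul_eq σ t y b x z
  have hu : Valued.v (((Units.mk0 (1 + y * x + b * z) h0 * (Units.mk0 (1 + β * ζ) hF0)⁻¹ : Kˣ) : K) - 1) ≤ Valued.v ϖ ^ n := by
    have hval : ((Units.mk0 (1 + y * x + b * z) h0 * (Units.mk0 (1 + β * ζ) hF0)⁻¹ : Kˣ) : K) = (1 + y * x + b * z) * (1 + β * ζ)⁻¹ := by
      simp only [Units.val_mul, Units.val_inv_eq_inv_val, Units.val_mk0]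
    rw [hval, show (1 + y * x + b * z) * (1 + β * ζ)⁻¹ - 1 = ((1 + y * x + b * z) - (1 + β * ζ)) * (1 + β * ζ)⁻¹ from by
        rw [sub_mul, mul_inv_cancel₀ hF0],
      map_mul, map_inv₀, hvF, inv_one, mul_one, hdecomp, hβdef, hζdef, add_sub_cancel_left]
    exact hE
  have h1' := hcond _ hu
  rw [map_mul, map_inv, hχF, inv_one, mul_one] at h1'
  exact h1'

include hvϖ in
/-- **The crude two-depth identity** (no trace-one element, no `σ`-fixed letter): if `n ≤ r + r′` AND `n ≤ s + s′` then `χ₁(1 + yx + bz) = 1` for `χ₁` trivial on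
`{u : |u − 1| ≤ |ϖ|ⁿ}` (`|yx + bz| ≤ |ϖ|ⁿ`).  At `(r, s, r′, s′) = (0, 0, n, n)` this is the level-`n` case of ★ `K2E3LevelNIwahoriCharacter`. [cite: Roche1998, §3] [cite: MoyPrasad1996, §3] -/
theorem chi_mk0_one_add_eq_one (χ₁ : Kˣ →* ℂˣ) {n : ℕ}
    (hcond : ∀ u : Kˣ, Valued.v ((u : K) - 1) ≤ Valued.v ϖ ^ n → χ₁ u = 1)
    {y b x z : K} {r s r' s' : ℕ} (hy : Valued.v y ≤ Valued.v ϖ ^ r) (hvb : Valued.v b ≤ Valued.v ϖ ^ s)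
    (hx : Valued.v x ≤ Valued.v ϖ ^ r') (hvz : Valued.v z ≤ Valued.v ϖ ^ s') (h1 : n ≤ r + r') (h4 : n ≤ s + s')
    (h0 : 1 + y * x + b * z ≠ 0) :
    χ₁ (Units.mk0 (1 + y * x + b * z) h0) = 1 := by
  refine hcond _ ?_
  rw [Units.val_mk0, show 1 + y * x + b * z - 1 = y * x + b * z by ring]
  exact Valued.v.map_add_le ((v_mul_le_pow_add hy hx).trans (v_pow_le_pow_of_le hvϖ h1)) ((v_mul_le_pow_add hvb hvz).trans (v_pow_le_pow_of_le hvϖ h4))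

end FieldLevel

/-! ## §2 Matrix level on `U(σ, Φ₃)`: `(jj′)₀₀ = j₀₀·j′₀₀·(1 + ỹx̃ + b̃z̃)` and the two isotropy relations -/

section MatrixLevel

variable {K : Type*} [Field K] [Valued K ℤᵐ⁰]
  (σ : K →+* K) {ϖ : K} {J : Matrix (Fin 3) (Fin 3) K} (hJ : J = (StdForm.antidiagonal 3).over K)
  (hσ : ∀ a, σ (σ a) = a) (hvσ : ∀ a, Valued.v (σ a) = Valued.v a) (hvϖ : Valued.v ϖ = WithZero.exp (-1 : ℤ))

omit [Valued K ℤᵐ⁰] in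
/-- **`(jj′)₀₀ = j₀₀·j′₀₀·(1 + ỹx̃ + b̃z̃)`** with `ỹ = j₀₁∕j₀₀`, `b̃ = j₀₂∕j₀₀` (row `0` of `j` normalised) and `x̃ = j′₁₀∕j′₀₀`, `z̃ = j′₂₀∕j′₀₀` (column `0` of `j′` normalised),
for `j₀₀, j′₀₀ ≠ 0` (`(jj′)₀₀ = j₀₀j′₀₀ + j₀₁j′₁₀ + j₀₂j′₂₀`). [cite: Rogawski1990, §1.9 p. 8] [cite: BruhatTits1972, (4.4.4)] -/
theorem mul_apply_zero_zero_eq (j j' : ↥(unitaryGroupOfForm σ J))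
    (h1 : ((j : GL (Fin 3) K) : Matrix (Fin 3) (Fin 3) K) 0 0 ≠ 0) (h2 : ((j' : GL (Fin 3) K) : Matrix (Fin 3) (Fin 3) K) 0 0 ≠ 0) :
    (((j * j' : ↥(unitaryGroupOfForm σ J)) : GL (Fin 3) K) : Matrix (Fin 3) (Fin 3) K) 0 0 =
      ((j : GL (Fin 3) K) : Matrix (Fin 3) (Fin 3) K) 0 0 * ((j' : GL (Fin 3) K) : Matrix (Fin 3) (Fin 3) K) 0 0 *
        (1 + (((j : GL (Fin 3) K) : Matrix (Fin 3) (Fin 3) K) 0 1 / ((j : GL (Fin 3) K) : Matrix (Fin 3) (Fin 3) K) 0 0) *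
              (((j' : GL (Fin 3) K) : Matrix (Fin 3) (Fin 3) K) 1 0 / ((j' : GL (Fin 3) K) : Matrix (Fin 3) (Fin 3) K) 0 0) +
          (((j : GL (Fin 3) K) : Matrix (Fin 3) (Fin 3) K) 0 2 / ((j : GL (Fin 3) K) : Matrix (Fin 3) (Fin 3) K) 0 0) *
              (((j' : GL (Fin 3) K) : Matrix (Fin 3) (Fin 3) K) 2 0 / ((j' : GL (Fin 3) K) : Matrix (Fin 3) (Fin 3) K) 0 0)) := by
  rw [Subgroup.coe_mul, Units.val_mul, Matrix.mul_apply, Fin.sum_univ_three]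
  field_simp

omit [Valued K ℤᵐ⁰] in
/-- **The pivot factorisation of `(jj′)₀₀` in `Kˣ`**: `(jj′)₀₀ = j₀₀ · j′₀₀ · (1 + ỹx̃ + b̃z̃)` as a product of three units (`mul_apply_zero_zero_eq`; the third factor is non-zero
because the product is). [cite: Rogawski1990, §1.9 p. 8] [cite: BruhatTits1972, (4.4.4)] -/
theorem mk0_mul_apply_zero_zero_eq (j j' : ↥(unitaryGroupOfForm σ J))
    (h0 : (((j * j' : ↥(unitaryGroupOfForm σ J)) : GL (Fin 3) K) : Matrix (Fin 3) (Fin 3) K) 0 0 ≠ 0)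
    (h10 : ((j : GL (Fin 3) K) : Matrix (Fin 3) (Fin 3) K) 0 0 ≠ 0) (h20 : ((j' : GL (Fin 3) K) : Matrix (Fin 3) (Fin 3) K) 0 0 ≠ 0) :
    ∃ hw0 : 1 + (((j : GL (Fin 3) K) : Matrix (Fin 3) (Fin 3) K) 0 1 / ((j : GL (Fin 3) K) : Matrix (Fin 3) (Fin 3) K) 0 0) *
          (((j' : GL (Fin 3) K) : Matrix (Fin 3) (Fin 3) K) 1 0 / ((j' : GL (Fin 3) K) : Matrix (Fin 3) (Fin 3) K) 0 0) +
        (((j : GL (Fin 3) K) : Matrix (Fin 3) (Fin 3) K) 0 2 / ((j : GL (Fin 3) K) : Matrix (Fin 3) (Fin 3) K) 0 0) *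
          (((j' : GL (Fin 3) K) : Matrix (Fin 3) (Fin 3) K) 2 0 / ((j' : GL (Fin 3) K) : Matrix (Fin 3) (Fin 3) K) 0 0) ≠ 0,
      Units.mk0 _ h0 = Units.mk0 _ h10 * Units.mk0 _ h20 * Units.mk0 _ hw0 := by
  have hmul := mul_apply_zero_zero_eq σ j j' h10 h20
  refine ⟨fun h => h0 (by rw [hmul, h, mul_zero]), ?_⟩
  ext; simp only [Units.val_mk0, Units.val_mul, hmul]

omit [Valued K ℤᵐ⁰] in
include hJ hσ in
/-- **Row `0` of `j ∈ U(σ, Φ₃)` is isotropic, normalised**: `b̃ + σb̃ + ỹσỹ = 0` for `ỹ = j₀₁∕j₀₀`, `b̃ = j₀₂∕j₀₀` (`j₀₀ ≠ 0`) — the isotropy of the LAST column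
`(σj₀₂, σj₀₁, σj₀₀)` of `j⁻¹ ∈ U` (★ `sum_rel_of_mem` at `(2,2)`, ★ `coe_inv_apply_eq`). [cite: Rogawski1990, §1.9 p. 8] -/
theorem row_zero_rel (j : ↥(unitaryGroupOfForm σ J)) (h1 : ((j : GL (Fin 3) K) : Matrix (Fin 3) (Fin 3) K) 0 0 ≠ 0) :
    ((j : GL (Fin 3) K) : Matrix (Fin 3) (Fin 3) K) 0 2 / ((j : GL (Fin 3) K) : Matrix (Fin 3) (Fin 3) K) 0 0 +
        σ (((j : GL (Fin 3) K) : Matrix (Fin 3) (Fin 3) K) 0 2 / ((j : GL (Fin 3) K) : Matrix (Fin 3) (Fin 3) K) 0 0) +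
      ((j : GL (Fin 3) K) : Matrix (Fin 3) (Fin 3) K) 0 1 / ((j : GL (Fin 3) K) : Matrix (Fin 3) (Fin 3) K) 0 0 *
        σ (((j : GL (Fin 3) K) : Matrix (Fin 3) (Fin 3) K) 0 1 / ((j : GL (Fin 3) K) : Matrix (Fin 3) (Fin 3) K) 0 0) = 0 := by
  have hσ1 : σ (((j : GL (Fin 3) K) : Matrix (Fin 3) (Fin 3) K) 0 0) ≠ 0 := (map_ne_zero σ).2 h1
  -- the `(2,2)` unitarity relation of `j⁻¹`: `∑ᵢ σ((j⁻¹)ᵢ₂) (j⁻¹)_{rev i, 2} = 0`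
  have r := sum_rel_of_mem σ hJ (j⁻¹) 2 2
  have r0 : Fin.rev (0 : Fin 3) = 2 := rfl
  have r1 : Fin.rev (1 : Fin 3) = 1 := rfl
  have r2 : Fin.rev (2 : Fin 3) = 0 := rfl
  simp only [Fin.sum_univ_three, coe_inv_apply_eq σ hJ j, hσ, r0, r1, r2, if_neg (show (2 : Fin 3) ≠ 0 by decide)] at r
  rw [map_div₀, map_div₀]
  field_simp
  linear_combination r

omit [Valued K ℤᵐ⁰] in
include hJ in
/-- **Column `0` of `j′ ∈ U(σ, Φ₃)` is isotropic, normalised**: `z̃ + σz̃ + x̃σx̃ = 0` for `x̃ = j′₁₀∕j′₀₀`, `z̃ = j′₂₀∕j′₀₀` (`j′₀₀ ≠ 0`; ★ `col_zero_isotropic`: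
`σa·c + σx·x + σc·a = 0` for the first column `(a, x, c)`). [cite: Rogawski1990, §1.9 p. 8] -/
theorem col_zero_rel (j' : ↥(unitaryGroupOfForm σ J)) (h2 : ((j' : GL (Fin 3) K) : Matrix (Fin 3) (Fin 3) K) 0 0 ≠ 0) :
    ((j' : GL (Fin 3) K) : Matrix (Fin 3) (Fin 3) K) 2 0 / ((j' : GL (Fin 3) K) : Matrix (Fin 3) (Fin 3) K) 0 0 +
        σ (((j' : GL (Fin 3) K) : Matrix (Fin 3) (Fin 3) K) 2 0 / ((j' : GL (Fin 3) K) : Matrix (Fin 3) (Fin 3) K) 0 0) +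
      ((j' : GL (Fin 3) K) : Matrix (Fin 3) (Fin 3) K) 1 0 / ((j' : GL (Fin 3) K) : Matrix (Fin 3) (Fin 3) K) 0 0 *
        σ (((j' : GL (Fin 3) K) : Matrix (Fin 3) (Fin 3) K) 1 0 / ((j' : GL (Fin 3) K) : Matrix (Fin 3) (Fin 3) K) 0 0) = 0 := by
  have hσ2 : σ (((j' : GL (Fin 3) K) : Matrix (Fin 3) (Fin 3) K) 0 0) ≠ 0 := (map_ne_zero σ).2 h2
  have hiso := col_zero_isotropic σ hJ j'
  rw [map_div₀, map_div₀]
  field_simp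
  linear_combination hiso

include hJ hσ hvσ hvϖ in
/-- **`χ₁((jj′)₀₀) = χ₁(j₀₀)·χ₁(j′₀₀)` ON ENTRY BOUNDS — THE TWO-DEPTH (ROCHE-REGIME) CHARACTER IDENTITY on `U(σ, Φ₃)`.**  For `j, j′ ∈ U(σ, Φ₃)` with unit pivots
`|j₀₀| = |j′₀₀| = 1`, row-`0` depths `|j₀₁| ≤ |ϖ|^r`, `|j₀₂| ≤ |ϖ|^s` and column-`0` depths `|j′₁₀| ≤ |ϖ|^{r′}`, `|j′₂₀| ≤ |ϖ|^{s′}`; a character `χ₁` trivial on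
`{u : |u − 1| ≤ |ϖ|ⁿ}` and on the `σ`-fixed `{u : σu = u, |u − 1| ≤ |ϖ|^c}` (`1 ≤ c ≤ n`); a trace-one `t` (`t + σt = 1`, `|t| ≤ 1`); and the concavity inequalities
`n ≤ r + r′`, `n ≤ 2r + s′`, `n ≤ s + 2r′`, `c ≤ s + s′`: `χ₁((jj′)₀₀) = χ₁(j₀₀)χ₁(j′₀₀)` (§2 `(jj′)₀₀ = j₀₀j′₀₀(1 + ỹx̃ + b̃z̃)` + §1).  This is the multiplicativity of
Roche's `χ̃(n̄ t n) = χ(t)` on the two-depth group `J_χ` of `U(2,1)` in the regime cond_F(χ₁) = `c` < `n` = cond_E(χ₁), where the uniform level `J_n` fails (p37 memo §9).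
[cite: Roche1998, §3] [cite: MoyPrasad1996, §3] [cite: BruhatTits1972, (6.4.9)] [cite: Casselman1995, §1.4] -/
theorem chi_mul_apply_zero_zero_of_traceOne (χ₁ : Kˣ →* ℂˣ) {n c : ℕ} (hc1 : 1 ≤ c) (hcn : c ≤ n)
    (hcond : ∀ u : Kˣ, Valued.v ((u : K) - 1) ≤ Valued.v ϖ ^ n → χ₁ u = 1)
    (hcondF : ∀ u : Kˣ, σ (u : K) = u → Valued.v ((u : K) - 1) ≤ Valued.v ϖ ^ c → χ₁ u = 1)
    {t : K} (ht : t + σ t = 1) (hvt : Valued.v t ≤ 1)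
    {j j' : ↥(unitaryGroupOfForm σ J)} (hj : Valued.v (((j : GL (Fin 3) K) : Matrix (Fin 3) (Fin 3) K) 0 0) = 1)
    (hj' : Valued.v (((j' : GL (Fin 3) K) : Matrix (Fin 3) (Fin 3) K) 0 0) = 1)
    {r s r' s' : ℕ} (hy : Valued.v (((j : GL (Fin 3) K) : Matrix (Fin 3) (Fin 3) K) 0 1) ≤ Valued.v ϖ ^ r)
    (hb : Valued.v (((j : GL (Fin 3) K) : Matrix (Fin 3) (Fin 3) K) 0 2) ≤ Valued.v ϖ ^ s)
    (hx : Valued.v (((j' : GL (Fin 3) K) : Matrix (Fin 3) (Fin 3) K) 1 0) ≤ Valued.v ϖ ^ r')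
    (hz : Valued.v (((j' : GL (Fin 3) K) : Matrix (Fin 3) (Fin 3) K) 2 0) ≤ Valued.v ϖ ^ s')
    (h1 : n ≤ r + r') (h2 : n ≤ 2 * r + s') (h3 : n ≤ s + 2 * r') (h4 : c ≤ s + s')
    (h0 : (((j * j' : ↥(unitaryGroupOfForm σ J)) : GL (Fin 3) K) : Matrix (Fin 3) (Fin 3) K) 0 0 ≠ 0)
    (h10 : (((j : GL (Fin 3) K) : Matrix (Fin 3) (Fin 3) K) 0 0) ≠ 0) (h20 : (((j' : GL (Fin 3) K) : Matrix (Fin 3) (Fin 3) K) 0 0) ≠ 0) :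
    χ₁ (Units.mk0 _ h0) = χ₁ (Units.mk0 _ h10) * χ₁ (Units.mk0 _ h20) := by
  obtain ⟨hw0, hunits⟩ := mk0_mul_apply_zero_zero_eq σ j j' h0 h10 h20
  rw [hunits, map_mul, map_mul, chi_mk0_one_add_eq_one_of_traceOne σ hσ hvσ hvϖ χ₁ hc1 hcn hcond hcondF ht hvt
    (row_zero_rel σ hJ hσ j h10) (col_zero_rel σ hJ j' h20) (by rw [map_div₀, hj, div_one]; exact hy) (by rw [map_div₀, hj, div_one]; exact hb)
    (by rw [map_div₀, hj', div_one]; exact hx) (by rw [map_div₀, hj', div_one]; exact hz) h1 h2 h3 h4 hw0, mul_one]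

include hvϖ in
/-- **The crude version on entry bounds** (no trace-one element, no `σ`-fixed letter): if `n ≤ r + r′` AND `n ≤ s + s′` then `χ₁((jj′)₀₀) = χ₁(j₀₀)χ₁(j′₀₀)` for `χ₁` trivial
on `{u : |u − 1| ≤ |ϖ|ⁿ}` and unit pivots.  At `(r, s, r′, s′) = (0, 0, n, n)` this is ★ `K2E3LevelNIwahoriCharacter.chi_apply_zero_zero_mul_pow` (the uniform `J_n`).
[cite: Roche1998, §3] [cite: MoyPrasad1996, §3] [cite: Casselman1995, §1.4] -/
theorem chi_mul_apply_zero_zero_of_le_add (χ₁ : Kˣ →* ℂˣ) {n : ℕ}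
    (hcond : ∀ u : Kˣ, Valued.v ((u : K) - 1) ≤ Valued.v ϖ ^ n → χ₁ u = 1)
    {j j' : ↥(unitaryGroupOfForm σ J)} (hj : Valued.v (((j : GL (Fin 3) K) : Matrix (Fin 3) (Fin 3) K) 0 0) = 1)
    (hj' : Valued.v (((j' : GL (Fin 3) K) : Matrix (Fin 3) (Fin 3) K) 0 0) = 1)
    {r s r' s' : ℕ} (hy : Valued.v (((j : GL (Fin 3) K) : Matrix (Fin 3) (Fin 3) K) 0 1) ≤ Valued.v ϖ ^ r)
    (hb : Valued.v (((j : GL (Fin 3) K) : Matrix (Fin 3) (Fin 3) K) 0 2) ≤ Valued.v ϖ ^ s)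
    (hx : Valued.v (((j' : GL (Fin 3) K) : Matrix (Fin 3) (Fin 3) K) 1 0) ≤ Valued.v ϖ ^ r')
    (hz : Valued.v (((j' : GL (Fin 3) K) : Matrix (Fin 3) (Fin 3) K) 2 0) ≤ Valued.v ϖ ^ s')
    (h1 : n ≤ r + r') (h4 : n ≤ s + s')
    (h0 : (((j * j' : ↥(unitaryGroupOfForm σ J)) : GL (Fin 3) K) : Matrix (Fin 3) (Fin 3) K) 0 0 ≠ 0)
    (h10 : (((j : GL (Fin 3) K) : Matrix (Fin 3) (Fin 3) K) 0 0) ≠ 0) (h20 : (((j' : GL (Fin 3) K) : Matrix (Fin 3) (Fin 3) K) 0 0) ≠ 0) :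
    χ₁ (Units.mk0 _ h0) = χ₁ (Units.mk0 _ h10) * χ₁ (Units.mk0 _ h20) := by
  obtain ⟨hw0, hunits⟩ := mk0_mul_apply_zero_zero_eq σ j j' h0 h10 h20
  rw [hunits, map_mul, map_mul, chi_mk0_one_add_eq_one hvϖ χ₁ hcond (by rw [map_div₀, hj, div_one]; exact hy)
    (by rw [map_div₀, hj, div_one]; exact hb) (by rw [map_div₀, hj', div_one]; exact hx) (by rw [map_div₀, hj', div_one]; exact hz) h1 h4 hw0, mul_one]

end MatrixLevel

/-! ## §3 Over D174's letters: the concave-exponent level group `Jg` (`hJg : k ∈ Jg ↔ ∀ i j, |k i j| ≤ |ϖ| ^ e i j`) -/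

section ConcaveLevel

variable {K : Type*} [Field K] [Valued K ℤᵐ⁰] [ValuativeRel K] [(Valued.v : Valuation K ℤᵐ⁰).Compatible]
  (σ : K →+* K) {ϖ : K} {J : Matrix (Fin 3) (Fin 3) K} (hJ : J = (StdForm.antidiagonal 3).over K)
  (hσ : ∀ a, σ (σ a) = a) (hvσ : ∀ a, Valued.v (σ a) = Valued.v a) (hvϖ : Valued.v ϖ = WithZero.exp (-1 : ℤ))
  (e : Fin 3 → Fin 3 → ℕ) (Jg : Subgroup ↥(unitaryGroupOfForm σ J))
  (hJg : ∀ k : ↥(unitaryGroupOfForm σ J), k ∈ Jg ↔ ∀ i j, Valued.v (((k : GL (Fin 3) K) : Matrix (Fin 3) (Fin 3) K) i j) ≤ Valued.v ϖ ^ e i j)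

include hJ hvσ hvϖ hJg in
/-- The `(0,0)` entry of an element of `Jg` is non-zero (`1 ≤ e 1 0`, `1 ≤ e 2 0`). [cite: BruhatTits1972, (4.4.4)] -/
theorem apply_zero_zero_ne_zero_of_mem (h10 : 1 ≤ e 1 0) (h20 : 1 ≤ e 2 0) {g : ↥(unitaryGroupOfForm σ J)} (hg : g ∈ Jg) :
    (((g : GL (Fin 3) K) : Matrix (Fin 3) (Fin 3) K) 0 0) ≠ 0 := by
  intro h
  have hv := K2E3IwahoriTwoDepthFactorisation.v_apply_zero_zero_eq_one_of_mem σ hJ hvσ hvϖ e Jg hJg h10 h20 hg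
  rw [h, map_zero] at hv
  exact zero_ne_one hv

include hJ hσ hvσ hvϖ hJg in
/-- **`θ(j) := χ₁(j₀₀)` IS MULTIPLICATIVE ON THE TWO-DEPTH GROUP `Jg` IN THE ROCHE REGIME — the (v)-θ^{<} letter.**  Let `e` be the exponent matrix of `Jg` with positive
lower exponents `1 ≤ e 1 0`, `1 ≤ e 2 0` and the CONCAVITY inequalities `n ≤ e 0 1 + e 1 0`, `n ≤ 2·e 0 1 + e 2 0`, `n ≤ e 0 2 + 2·e 1 0`, `c ≤ e 0 2 + e 2 0` (`1 ≤ c ≤ n`);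
let `χ₁` be trivial on `{u : |u − 1| ≤ |ϖ|ⁿ}` and on the `σ`-fixed `{u : σu = u, |u − 1| ≤ |ϖ|^c}`; let `t + σt = 1`, `|t| ≤ 1`.  Then for `j, j′ ∈ Jg`:
`χ₁((jj′)₀₀) = χ₁(j₀₀)·χ₁(j′₀₀)`.  (Roche's `J_χ` for `χ = χ₁ ⊗ 1` on `U(2,1)`: short-root depths `e 0 1 + e 1 0 = cond_E χ₁`, long-root depths `e 0 2 + e 2 0 = cond_F χ₁`.)
[cite: Roche1998, §3] [cite: MoyPrasad1996, §3] [cite: BruhatTits1972, (6.4.9)] [cite: Casselman1995, §1.4] -/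
theorem chi_apply_zero_zero_mul_of_concave (h10e : 1 ≤ e 1 0) (h20e : 1 ≤ e 2 0) (χ₁ : Kˣ →* ℂˣ) {n c : ℕ} (hc1 : 1 ≤ c) (hcn : c ≤ n)
    (hcond : ∀ u : Kˣ, Valued.v ((u : K) - 1) ≤ Valued.v ϖ ^ n → χ₁ u = 1)
    (hcondF : ∀ u : Kˣ, σ (u : K) = u → Valued.v ((u : K) - 1) ≤ Valued.v ϖ ^ c → χ₁ u = 1)
    {t : K} (ht : t + σ t = 1) (hvt : Valued.v t ≤ 1)
    (h1 : n ≤ e 0 1 + e 1 0) (h2 : n ≤ 2 * e 0 1 + e 2 0) (h3 : n ≤ e 0 2 + 2 * e 1 0) (h4 : c ≤ e 0 2 + e 2 0)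
    {j j' : ↥(unitaryGroupOfForm σ J)} (hj : j ∈ Jg) (hj' : j' ∈ Jg)
    (h0 : (((j * j' : ↥(unitaryGroupOfForm σ J)) : GL (Fin 3) K) : Matrix (Fin 3) (Fin 3) K) 0 0 ≠ 0)
    (h10 : (((j : GL (Fin 3) K) : Matrix (Fin 3) (Fin 3) K) 0 0) ≠ 0) (h20 : (((j' : GL (Fin 3) K) : Matrix (Fin 3) (Fin 3) K) 0 0) ≠ 0) :
    χ₁ (Units.mk0 _ h0) = χ₁ (Units.mk0 _ h10) * χ₁ (Units.mk0 _ h20) :=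
  chi_mul_apply_zero_zero_of_traceOne σ hJ hσ hvσ hvϖ χ₁ hc1 hcn hcond hcondF ht hvt
    (K2E3IwahoriTwoDepthFactorisation.v_apply_zero_zero_eq_one_of_mem σ hJ hvσ hvϖ e Jg hJg h10e h20e hj)
    (K2E3IwahoriTwoDepthFactorisation.v_apply_zero_zero_eq_one_of_mem σ hJ hvσ hvϖ e Jg hJg h10e h20e hj')
    (((hJg j).1 hj) 0 1) (((hJg j).1 hj) 0 2) (((hJg j').1 hj') 1 0) (((hJg j').1 hj') 2 0) h1 h2 h3 h4 h0 h10 h20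

include hJ hvσ hvϖ hJg in
/-- **The crude regime on `Jg`**: if `n ≤ e 0 1 + e 1 0` AND `n ≤ e 0 2 + e 2 0` (`1 ≤ e 1 0`, `1 ≤ e 2 0`) then `χ₁((jj′)₀₀) = χ₁(j₀₀)χ₁(j′₀₀)` on `Jg` for `χ₁` trivial on
`{u : |u − 1| ≤ |ϖ|ⁿ}` — the uniform-`J_n` theorem ★ `chi_apply_zero_zero_mul_pow` is the instance `e = ![![0,0,0],![n,0,0],![n,n,0]]`. [cite: Roche1998, §3] [cite: MoyPrasad1996, §3] -/
theorem chi_apply_zero_zero_mul_of_le_add (h10e : 1 ≤ e 1 0) (h20e : 1 ≤ e 2 0) (χ₁ : Kˣ →* ℂˣ) {n : ℕ}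
    (hcond : ∀ u : Kˣ, Valued.v ((u : K) - 1) ≤ Valued.v ϖ ^ n → χ₁ u = 1)
    (h1 : n ≤ e 0 1 + e 1 0) (h4 : n ≤ e 0 2 + e 2 0)
    {j j' : ↥(unitaryGroupOfForm σ J)} (hj : j ∈ Jg) (hj' : j' ∈ Jg)
    (h0 : (((j * j' : ↥(unitaryGroupOfForm σ J)) : GL (Fin 3) K) : Matrix (Fin 3) (Fin 3) K) 0 0 ≠ 0)
    (h10 : (((j : GL (Fin 3) K) : Matrix (Fin 3) (Fin 3) K) 0 0) ≠ 0) (h20 : (((j' : GL (Fin 3) K) : Matrix (Fin 3) (Fin 3) K) 0 0) ≠ 0) :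
    χ₁ (Units.mk0 _ h0) = χ₁ (Units.mk0 _ h10) * χ₁ (Units.mk0 _ h20) :=
  chi_mul_apply_zero_zero_of_le_add σ hvϖ χ₁ hcond
    (K2E3IwahoriTwoDepthFactorisation.v_apply_zero_zero_eq_one_of_mem σ hJ hvσ hvϖ e Jg hJg h10e h20e hj)
    (K2E3IwahoriTwoDepthFactorisation.v_apply_zero_zero_eq_one_of_mem σ hJ hvσ hvϖ e Jg hJg h10e h20e hj')
    (((hJg j).1 hj) 0 1) (((hJg j).1 hj) 0 2) (((hJg j').1 hj') 1 0) (((hJg j').1 hj') 2 0) h1 h4 h0 h10 h20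

end ConcaveLevel

end Summit.HodgeConjecture.HodgeConjecture.Cruxes.H413.K2E3ConcaveLevelIwahoriCharacter

end
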